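/-
Copyright (c) 2026 the pub-hodgecm-mathlib formalisation cell (harness21).  Prover seat hodgecm-mathlib-K2Liu-p06 (g4), Track B «K2-LIT»,
#184♮ = hLiu418 = `stmt-HodgeConjecture-24832`; #42S payer road, organ S1 (local Siegel–Weil spanning), ROAD W file F3c-B1 (geometry of the big cell,
topological half, part 1: OPENNESS; RULINGS «M-157t», «M-158a»).
-/
import Summits.HodgeConjecture.HodgeConjecture.Theorems.K2LiuLocalSWBigCellDecomposition   -- ★ F3c-A: `mem_bigCell_iff_isUnit_det_blkC`
import Literature.NumberTheory.GelbartRogawski1991.LocalDoubledUnitaryIwahori               -- ★ `adComp`, `continuous_adComp`, `coe_adComp`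
import HarnessLib

/-!
# Crux `HLiu418`, #42S organ S1, ROAD W, file F3c-B1: THE BIG CELL `P_Δ w_Δ N_Δ` OF THE LOCAL DOUBLED UNITARY GROUP IS OPEN

Cell `hodgecm-mathlib`, crux item hLiu418 = `stmt-HodgeConjecture-24832`; squad K2 ∕ K2Liu; prover K2Liu-p06 (g4), the dedicated S1 hand.
THEOREMS ONLY (no `def`, no instance, no notation, no named-fact hypothesis, no `sorry`); lane `--supports stmt-HodgeConjecture-24832 --as helper`.

WHY.  ★ F2 `mem_of_bigCell_pieces_mem` ∕ ★ F3b `spanning_criterion` take the big cell `Ω = P_Δ w_Δ N_Δ` OPEN, BY VALUE.  ★ F3c-A identified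
`Ω = {g : C(g) invertible}` (`C` = the `Δ → Δ⁻` adapted block, ★ `AdaptedBlocks.blkC ∘ matA`).  Here: `C(g)` invertible over `E ⊗ F_v = Π_{w∣v} E_w` iff
`det C(g)_w ≠ 0` at every `w ∣ v` (`Pi.isUnit_iff`), the `w`-component `C(g)_w` is the lower-left block of the adapted `w`-component ★ `adComp w g`
(★ `coe_adComp`), which is continuous in `g` (★ `continuous_adComp`); so `Ω` is a finite intersection of preimages of `{det ≠ 0}` — OPEN
(`isOpen_setOf_isUnit_det_blkC`, **`isOpen_bigCell`**).  Part 2 (F3c-B2) supplies the continuity of the `N_Δ`-coordinate `g ↦ n(C⁻¹D)` on `Ω` and the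
contracting Levi scalars — the remaining BY-VALUE geometry of (SC).
References: [Kudla1994] §3; [Weil1964] n° 32; [BernsteinZelevinsky1976] §1.5 (the open Bruhat cell); [HarrisKudlaSweet1996] §1 (1.11).
HONEST LABEL.  Count-neutral helper: `HC_CM` is proved only modulo the 7 printed citations (2 remaining named inputs: hLiu418 = `stmt-HodgeConjecture-24832`,
h413 = `stmt-HodgeConjecture-24833`) until rung 0 closes.
-/

set_option autoImplicit false
set_option linter.dupNamespace false -- the mandated namespace repeats `HodgeConjecture.HodgeConjecture`

noncomputable section

open NumberField IsDedekindDomain Matrix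
open Literature.NumberTheory.Automorphic Literature.NumberTheory.Automorphic.UnitaryGroup
open Literature.NumberTheory.GelbartRogawski1991.AdaptedBlocks
open Literature.NumberTheory.GelbartRogawski1991.UnitaryDualPair.LocalSplitting
open Literature.NumberTheory.K2Lit.LocalSiegelDoubled
open Summit.HodgeConjecture.HodgeConjecture.Cruxes.HLiu418.K2LiuLocalSWBigCellDecomposition

namespace Summit.HodgeConjecture.HodgeConjecture.Cruxes.HLiu418.K2LiuLocalSWBigCellTopology

variable (F : Type) [Field F] [NumberField F] (E : Type) [Field E] [NumberField E] [Algebra F E]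
  (c : E ≃ₐ[F] E)
  {δ : E} (hcδ : c δ = -δ) (hδ : δ ≠ 0) {d : F} (hd : δ * δ = algebraMap F E d)
  (v : HeightOneSpectrum (𝓞 F)) (n : ℕ) {T₀ : Matrix (Fin n) (Fin n) F} (hT₀ : T₀.IsSymm) (hT₀d : IsUnit T₀.det)
  {JD : Matrix (Fin (n + n)) (Fin (n + n)) E} (hJD : JD = (gramD F n T₀).map (algebraMap F E))

/-! ## §1 The `w`-components of the adapted matrix are continuous -/

/-- **the adapted matrix read at a place `w ∣ v`**: `(adapt (matA g)).map (·)_w = e₂⁻¹-reindex of the matrix of ★ `adComp w g`**. [cite: Kudla1994, §3] -/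
theorem adapt_matA_map_eval (w : PlacesOver E v) (g : UnitaryGroup.localPi E c (n + n) JD v) :
    (adapt (matA F E c v n g)).map (Pi.evalRingHom (fun w' : PlacesOver E v => w'.1.adicCompletion E) w) =
      Matrix.reindex (e₂ n).symm (e₂ n).symm
        ((adComp F E c v n w g : GL (Fin (n + n)) (w.1.adicCompletion E)) : Matrix (Fin (n + n)) (Fin (n + n)) (w.1.adicCompletion E)) := by
  rw [coe_adComp, Matrix.reindex_apply, Matrix.reindex_apply, Matrix.submatrix_map, Matrix.submatrix_submatrix, Equiv.self_comp_symm,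
    Matrix.submatrix_id_id]

/-- `g ↦ (adapt (matA g))_w` is continuous (★ `continuous_adComp`). [cite: MoeglinVignerasWaldspurger1987, Chap. 2 II.8] -/
theorem continuous_adapt_matA_map_eval (w : PlacesOver E v) :
    Continuous fun g : UnitaryGroup.localPi E c (n + n) JD v =>
      (adapt (matA F E c v n g)).map (Pi.evalRingHom (fun w' : PlacesOver E v => w'.1.adicCompletion E) w) := by
  simp only [adapt_matA_map_eval]
  exact (Units.continuous_val.comp (continuous_adComp F E c v n w)).matrix_submatrix _ _

/-- `g ↦ det (C(g)_w)` is continuous. [cite: MoeglinVignerasWaldspurger1987, Chap. 2 II.8] -/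
theorem continuous_det_blkC_map_eval (w : PlacesOver E v) :
    Continuous fun g : UnitaryGroup.localPi E c (n + n) JD v =>
      ((blkC (matA F E c v n g)).map (Pi.evalRingHom (fun w' : PlacesOver E v => w'.1.adicCompletion E) w)).det := by
  have hblk : ∀ g : UnitaryGroup.localPi E c (n + n) JD v,
      (blkC (matA F E c v n g)).map (Pi.evalRingHom (fun w' : PlacesOver E v => w'.1.adicCompletion E) w) =
        ((adapt (matA F E c v n g)).map (Pi.evalRingHom (fun w' : PlacesOver E v => w'.1.adicCompletion E) w)).toBlocks₂₁ := by
    intro g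
    rw [blkC_eq_toBlocks₂₁_adapt]
    rfl
  simp only [hblk]
  refine Continuous.matrix_det ?_
  exact (continuous_adapt_matA_map_eval F E c v n w).matrix_submatrix Sum.inr Sum.inl

/-! ## §2 `{C invertible}` is open; the big cell is open -/

/-- **`det C(g)` is a unit of `E ⊗ F_v` iff `det C(g)_w ≠ 0` at every `w ∣ v`.** [cite: Kudla1994, §3] -/
theorem isUnit_det_blkC_iff_forall (g : UnitaryGroup.localPi E c (n + n) JD v) :
    IsUnit (blkC (matA F E c v n g)).det ↔
      ∀ w : PlacesOver E v, ((blkC (matA F E c v n g)).map (Pi.evalRingHom (fun w' : PlacesOver E v => w'.1.adicCompletion E) w)).det ≠ 0 := by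
  rw [Pi.isUnit_iff]
  refine forall_congr' fun w => ?_
  rw [← RingHom.mapMatrix_apply, ← RingHom.map_det, isUnit_iff_ne_zero]
  rfl

/-- **`{g : C(g) invertible}` IS OPEN in `H(F_v)`.** [cite: BernsteinZelevinsky1976, §1.5] [cite: Kudla1994, §3] -/
theorem isOpen_setOf_isUnit_det_blkC :
    IsOpen {g : UnitaryGroup.localPi E c (n + n) JD v | IsUnit (blkC (matA F E c v n g)).det} := by
  have : {g : UnitaryGroup.localPi E c (n + n) JD v | IsUnit (blkC (matA F E c v n g)).det} =
      ⋂ w : PlacesOver E v, {g | ((blkC (matA F E c v n g)).map (Pi.evalRingHom (fun w' : PlacesOver E v => w'.1.adicCompletion E) w)).det ≠ 0} := by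
    ext g
    rw [Set.mem_setOf_eq, isUnit_det_blkC_iff_forall, Set.mem_iInter]
    rfl
  rw [this]
  exact isOpen_iInter_of_finite fun w => isOpen_ne.preimage (continuous_det_blkC_map_eval F E c v n w)

include hcδ hδ hd hT₀ hT₀d in
/-- **THE BIG CELL `P_Δ · w_Δ · N_Δ(F_v)` IS OPEN in `H(F_v)`** (★ F3c-A `mem_bigCell_iff_isUnit_det_blkC` + `isOpen_setOf_isUnit_det_blkC`) — the `hΩ` binder of
★ F2 `mem_of_bigCell_pieces_mem` ∕ ★ F3b `spanning_criterion`. [cite: BernsteinZelevinsky1976, §1.5] [cite: Kudla1994, §3] [cite: Weil1964, n° 32] -/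
theorem isOpen_bigCell [Algebra.IsQuadraticExtension F E] :
    IsOpen {g : UnitaryGroup.localPi E c (n + n) JD v |
      ∃ p, IsSiegelDelta F E c hcδ hδ hd v n hT₀ hJD p ∧ ∃ u ∈ unipDeltaLocal F E c v n (JD := JD), g = p * weylDelta F E c v n hJD * u} := by
  have : {g : UnitaryGroup.localPi E c (n + n) JD v |
      ∃ p, IsSiegelDelta F E c hcδ hδ hd v n hT₀ hJD p ∧ ∃ u ∈ unipDeltaLocal F E c v n (JD := JD), g = p * weylDelta F E c v n hJD * u} =
      {g | IsUnit (blkC (matA F E c v n g)).det} :=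
    Set.ext fun g => mem_bigCell_iff_isUnit_det_blkC F E c hcδ hδ hd v n hT₀ hT₀d hJD g
  rw [this]
  exact isOpen_setOf_isUnit_det_blkC F E c v n

end Summit.HodgeConjecture.HodgeConjecture.Cruxes.HLiu418.K2LiuLocalSWBigCellTopology

end
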